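import Mathlib
import Literature.Probability.LatticeModels.LatticeGraph

/-!
# Closure of the probability-GSM cone on `ℤ³` under tight pointwise limits

Pure measure theory (Prokhorov + portmanteau), used by line `Sketch` of the crux
`CriticalTwoPointGSM` (stmt-CriticalPhenomena-8365): if kernels `G n : ℤ³ → ℝ` are Gaussian scale
mixtures `G n x = ∫ exp(-∑ᵢ sᵢ xᵢ²) dνₙ(s)` with probability mixing measures `νₙ` carried by the
closed octant `{s | ∀ i, 0 ≤ sᵢ}`, the family `{νₙ}` is tight, and `G n → Glim` pointwise on `ℤ³`,
then `Glim` is again such a mixture, by a probability measure on the closed octant.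

Proof: Prokhorov's theorem (`MeasureTheory.isCompact_closure_of_isTightMeasureSet`) and
Lévy–Prokhorov metrisability of `ProbabilityMeasure (Fin 3 → ℝ)` give a weakly convergent
subsequence `ν_{φ n} → μ`; the open set `{s | ∃ i, sᵢ < 0}` is `μ`-null by the portmanteau
inequality `μ U ≤ liminf ν_{φ n} U = 0`; and the integrals converge because on the closed octant the
kernel `s ↦ exp(-∑ sᵢxᵢ²)` agrees with the bounded continuous truncated kernel
`s ↦ exp(-∑ max(sᵢ,0) xᵢ²) ∈ (0,1]`, against which weak convergence can be tested.
-/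

namespace Summit.CriticalPhenomena.Ising3DConformalLimit.Theorems

open MeasureTheory Filter Topology
open Literature.Probability.LatticeModels
open scoped BigOperators

namespace CriticalTwoPointGSMClosure

/-- A measure giving no mass to `{s | ∃ i, sᵢ < 0}` is carried by the closed octant:
almost every point has nonnegative coordinates. -/
theorem ae_nonneg_of_octant {ν : Measure (Fin 3 → ℝ)} (hoct : ν {s | ∃ i, s i < 0} = 0) :
    ∀ᵐ s ∂ν, ∀ i, 0 ≤ s i := by
  rw [ae_iff]
  have : {a : Fin 3 → ℝ | ¬∀ (i : Fin 3), 0 ≤ a i} = {s | ∃ i, s i < 0} := by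
    ext s; simp [not_le]
  rw [this]; exact hoct

/-- The complement of the closed octant, `{s | ∃ i, sᵢ < 0}`, is open. -/
theorem isOpen_exists_neg : IsOpen {s : Fin 3 → ℝ | ∃ i, s i < 0} := by
  have : {s : Fin 3 → ℝ | ∃ i, s i < 0} = ⋃ i, {s | s i < 0} := by
    ext s; simp
  rw [this]
  exact isOpen_iUnion fun i => isOpen_lt (continuous_apply i) continuous_const

/-- The truncated Gaussian kernel `s ↦ exp(-∑ max(sᵢ,0) xᵢ²)` is continuous. -/
theorem continuous_truncKernel (x : Site 3) :
    Continuous fun s : Fin 3 → ℝ => Real.exp (-∑ i, max (s i) 0 * ((x i : ℝ)) ^ 2) := by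
  fun_prop

/-- The truncated Gaussian kernel takes values of norm at most `1`. -/
theorem norm_truncKernel_le_one (x : Site 3) (s : Fin 3 → ℝ) :
    ‖Real.exp (-∑ i, max (s i) 0 * ((x i : ℝ)) ^ 2)‖ ≤ 1 := by
  rw [Real.norm_eq_abs, abs_of_pos (Real.exp_pos _), Real.exp_le_one_iff]
  have : 0 ≤ ∑ i, max (s i) 0 * ((x i : ℝ)) ^ 2 :=
    Finset.sum_nonneg fun i _ => mul_nonneg (le_max_right _ _) (sq_nonneg _)
  linarith

/-- On a measure carried by the closed octant, the truncated kernel and the Gaussian kernel have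
the same integral. -/
theorem integral_truncKernel_eq {ν : Measure (Fin 3 → ℝ)} (hoct : ν {s | ∃ i, s i < 0} = 0)
    (x : Site 3) :
    ∫ s, Real.exp (-∑ i, max (s i) 0 * ((x i : ℝ)) ^ 2) ∂ν =
      ∫ s, Real.exp (-∑ i, s i * ((x i : ℝ)) ^ 2) ∂ν := by
  refine integral_congr_ae ?_
  filter_upwards [ae_nonneg_of_octant hoct] with s hs
  simp only [max_eq_left (hs _)]

end CriticalTwoPointGSMClosure

open CriticalTwoPointGSMClosure in
/-- **Closure of the probability-GSM cone on `ℤ³` under tight pointwise limits.** If kernels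
`G n` on `ℤ³` are represented by probability measures `ν n` on the closed octant,
`G n x = ∫ exp(-∑ᵢ sᵢ xᵢ²) dνₙ(s)`, the family `{ν n}` is tight, and `G n → Glim` pointwise, then
`Glim` is represented in the same way by a probability measure on the closed octant.
(Prokhorov + portmanteau; weak convergence is tested on the bounded continuous truncated kernels
`exp(-∑ max(sᵢ,0) xᵢ²)`, which agree with the kernel where all the measures live.) -/
theorem gsmClosure_of_tight (G : ℕ → Site 3 → ℝ) (Glim : Site 3 → ℝ) (ν : ℕ → Measure (Fin 3 → ℝ))
    (hP : ∀ n, IsProbabilityMeasure (ν n)) (hoct : ∀ n, (ν n) {s | ∃ i, s i < 0} = 0)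
    (hrep : ∀ n (x : Site 3), G n x = ∫ s, Real.exp (-∑ i, s i * ((x i : ℝ)) ^ 2) ∂(ν n))
    (htight : IsTightMeasureSet (Set.range ν))
    (hlim : ∀ x : Site 3, Tendsto (fun n => G n x) atTop (𝓝 (Glim x))) :
    ∃ μ : Measure (Fin 3 → ℝ), IsProbabilityMeasure μ ∧ μ {s | ∃ i, s i < 0} = 0 ∧
      ∀ x : Site 3, Glim x = ∫ s, Real.exp (-∑ i, s i * ((x i : ℝ)) ^ 2) ∂μ := by
  -- Step 1: package the `ν n` as probability measures; tightness transfers verbatim.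
  let P : ℕ → ProbabilityMeasure (Fin 3 → ℝ) := fun n => ⟨ν n, hP n⟩
  have htight' : IsTightMeasureSet
      {((Q : ProbabilityMeasure (Fin 3 → ℝ)) : Measure (Fin 3 → ℝ)) | Q ∈ Set.range P} := by
    have hS : {((Q : ProbabilityMeasure (Fin 3 → ℝ)) : Measure (Fin 3 → ℝ)) | Q ∈ Set.range P} =
        Set.range ν := by
      ext ρ
      simp only [Set.mem_setOf_eq, Set.mem_range, exists_exists_eq_and]
      rfl
    rw [hS]
    exact htight
  -- Step 2: Prokhorov + Lévy–Prokhorov metrisability: a weakly convergent subsequence.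
  obtain ⟨μ, -, φ, hφ, hμ⟩ := (isCompact_closure_of_isTightMeasureSet htight').tendsto_subseq
    (x := P) fun n => subset_closure (Set.mem_range_self n)
  -- Step 3: the limit is carried by the closed octant (portmanteau for the open complement).
  have hoctμ : (μ : Measure (Fin 3 → ℝ)) {s | ∃ i, s i < 0} = 0 := by
    have h := ProbabilityMeasure.le_liminf_measure_open_of_tendsto hμ isOpen_exists_neg
    have h0 : (fun n => ((P ∘ φ) n : Measure (Fin 3 → ℝ)) {s | ∃ i, s i < 0}) = fun _ => 0 := by
      funext n
      exact hoct (φ n)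
    rw [h0, liminf_const] at h
    exact le_antisymm h bot_le
  refine ⟨μ, inferInstance, hoctμ, fun x => ?_⟩
  -- Step 4: test weak convergence on the bounded continuous truncated kernel.
  let f : BoundedContinuousFunction (Fin 3 → ℝ) ℝ :=
    BoundedContinuousFunction.ofNormedAddCommGroup
      (fun s : Fin 3 → ℝ => Real.exp (-∑ i, max (s i) 0 * ((x i : ℝ)) ^ 2))
      (continuous_truncKernel x) 1 (norm_truncKernel_le_one x)
  have hf := (ProbabilityMeasure.tendsto_iff_forall_integral_tendsto.1 hμ) f
  have h1 : (fun n => ∫ s, f s ∂((P ∘ φ) n : Measure (Fin 3 → ℝ))) = fun n => G (φ n) x := by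
    funext n
    rw [hrep]
    exact integral_truncKernel_eq (hoct (φ n)) x
  have h2 : ∫ s, f s ∂(μ : Measure (Fin 3 → ℝ)) =
      ∫ s, Real.exp (-∑ i, s i * ((x i : ℝ)) ^ 2) ∂(μ : Measure (Fin 3 → ℝ)) :=
    integral_truncKernel_eq hoctμ x
  rw [h1, h2] at hf
  exact tendsto_nhds_unique ((hlim x).comp hφ.tendsto_atTop) hf

end Summit.CriticalPhenomena.Ising3DConformalLimit.Theorems
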